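import Mathlib.Data.Prod.Lex
import Mathlib.Data.Finset.Max
import Mathlib.Tactic.IntervalCases
import Literature.Topology.PlaneTopology.RectilinearLoopMoves
import HarnessLib

/-!
# Rectilinear lattice loops: small loops, the top-left corner, and the diagonal chain of corners

Topic `Literature/Topology/PlaneTopology`; third file of the rectilinear Umlaufsatz
(`RectilinearLoops.lean`, `RectilinearLoopMoves.lean`, `RectilinearUmlaufsatz.lean`). Proved
here:

* loops of length `3` do not exist (`not_isLoop_three`, parity) and loops of length `4` are unit
  squares turning by `±4` (`cycTurn_four`, a finite check);
* every nonempty list of lattice points has a **top-left** point (`exists_topleft`), and the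
  top-left vertex of a loop is a corner of type `{e₀, -e₁}` (`cornerAt_topleft`): nothing lies
  above it or to its left on its row;
* **moving along the diagonal** (`cornerAt_next`): if `v` is a corner of type `{e₀, -e₁}` and
  the opposite cell corner `v' = v + e₀ - e₁` is a vertex of the loop other than the two vertices
  at distance two from `v` along the loop, then `v'` is again such a corner — its neighbours along
  the loop cannot be the neighbours `v + e₀ = v' + e₁`, `v - e₁ = v' - e₀` of `v`, whose own
  neighbours are known (an index computation in the rotation `window_at`).

Folklore (the standard reduction of orthogonal lattice polygons). [folklore]
-/

namespace Literature.Topology.PlaneTopology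

namespace RectLoop

open List

/-! ### Small loops -/

/-- Three unit steps never close up (parity). [folklore] -/
theorem dir_add_three_ne_zero : ∀ i j k : Fin 4, dir i + dir j + dir k ≠ 0 := by decide

/-- There is no loop with three vertices. [folklore] -/
theorem not_isLoop_three (x₀ x₁ x₂ : ℤ × ℤ) : ¬ IsLoop [x₀, x₁, x₂] := by
  intro h
  have hc := h.chain
  simp only [cons_append, take_succ_cons, take_zero, nil_append, isChain_cons_cons] at hc
  obtain ⟨⟨i, hi⟩, ⟨j, hj⟩, ⟨k, hk⟩, -⟩ := hc
  refine dir_add_three_ne_zero i j k ?_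
  have : x₀ = x₀ + (dir i + dir j + dir k) := by
    conv_lhs => rw [hk, hj, hi]
    abel
  simpa using this.symm

set_option synthInstance.maxSize 1024 in
/-- The unit square: four unit steps closing up without immediate returns turn by `±4`.
[folklore] -/
theorem square_identity : ∀ i j k m : Fin 4, dir i + dir j + dir k + dir m = 0 →
    dir i + dir j ≠ 0 → dir j + dir k ≠ 0 →
    (cross (dir i) (dir j) + cross (dir j) (dir k) + cross (dir k) (dir m) + cross (dir m) (dir i) = 4 ∨
      cross (dir i) (dir j) + cross (dir j) (dir k) + cross (dir k) (dir m) + cross (dir m) (dir i) = -4) := by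
  decide

/-- A loop with four vertices turns by `±4`. [folklore] -/
theorem cycTurn_four {x₀ x₁ x₂ x₃ : ℤ × ℤ} (h : IsLoop [x₀, x₁, x₂, x₃]) :
    cycTurn [x₀, x₁, x₂, x₃] = 4 ∨ cycTurn [x₀, x₁, x₂, x₃] = -4 := by
  have hc := h.chain
  have hnd := h.nodup
  simp only [cons_append, take_succ_cons, take_zero, nil_append, isChain_cons_cons] at hc
  simp only [nodup_cons, mem_cons, not_or] at hnd
  obtain ⟨⟨i, hi⟩, ⟨j, hj⟩, ⟨k, hk⟩, ⟨m, hm⟩, -⟩ := hc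
  have key := square_identity i j k m ?_ ?_ ?_
  · simp only [cycTurn, cons_append, take_succ_cons, take_zero, nil_append, turnSum_cons_cons_cons,
      turnSum_pair, add_zero]
    have e1 : x₁ - x₀ = dir i := by rw [hi]; abel
    have e2 : x₂ - x₁ = dir j := by rw [hj]; abel
    have e3 : x₃ - x₂ = dir k := by rw [hk]; abel
    have e4 : x₀ - x₃ = dir m := by rw [hm]; abel
    rw [e1, e2, e3, e4]
    simpa only [add_assoc] using key
  · have : x₀ = x₀ + (dir i + dir j + dir k + dir m) := by
      conv_lhs => rw [hm, hk, hj, hi]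
      abel
    simpa using this.symm
  · intro e; apply hnd.1.2.1   -- x₀ = x₂
    rw [hj, hi, add_assoc, e, add_zero]
  · intro e; apply hnd.2.1.2.1 -- x₁ = x₃
    rw [hk, hj, add_assoc, e, add_zero]

/-! ### The top-left vertex -/

/-- A nonempty list of lattice points has a **top-left** point: maximal ordinate, and among those
minimal abscissa. [folklore] -/
theorem exists_topleft {l : List (ℤ × ℤ)} (hl : l ≠ []) :
    ∃ q ∈ l, ∀ p ∈ l, p.2 < q.2 ∨ (p.2 = q.2 ∧ q.1 ≤ p.1) := by
  have hne : l.toFinset.Nonempty := by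
    obtain ⟨x, hx⟩ := exists_mem_of_ne_nil l hl
    exact ⟨x, mem_toFinset.2 hx⟩
  obtain ⟨q, hq, hmax⟩ := l.toFinset.exists_max_image (fun p : ℤ × ℤ => toLex (p.2, -p.1)) hne
  refine ⟨q, mem_toFinset.1 hq, fun p hp => ?_⟩
  have := hmax p (mem_toFinset.2 hp)
  rcases Prod.Lex.toLex_le_toLex.1 this with h | ⟨h1, h2⟩
  · exact Or.inl h
  · exact Or.inr ⟨h1, by simpa using h2⟩

/-- At a top-left point `q`, a lattice neighbour `q + dir c` lying in the list is `q + e₀` or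
`q - e₁`. [folklore] -/
theorem dir_eq_of_topleft {l : List (ℤ × ℤ)} {q : ℤ × ℤ}
    (hq : ∀ p ∈ l, p.2 < q.2 ∨ (p.2 = q.2 ∧ q.1 ≤ p.1)) {c : Fin 4} (hc : q + dir c ∈ l) :
    c = 0 ∨ c = 3 := by
  have := hq _ hc
  fin_cases c
  · simp
  · exfalso; simp [dir] at this
  · exfalso; simp [dir] at this
  · simp

/-! ### Corners of type `{e₀, -e₁}` -/

/-- The top-left vertex of a loop with at least five vertices is a corner of type `{e₀, -e₁}`.
[folklore] -/
theorem cornerAt_topleft {l : List (ℤ × ℤ)} (hl : IsLoop l) (h5 : 5 ≤ l.length) {q : ℤ × ℤ}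
    (hq : q ∈ l) (htop : ∀ p ∈ l, p.2 < q.2 ∨ (p.2 = q.2 ∧ q.1 ≤ p.1)) : CornerAt l q := by
  obtain ⟨x₀, x₁, x₃, x₄, R, hrot⟩ := exists_window_two h5 hq
  have hL : IsLoop (x₀ :: x₁ :: q :: x₃ :: x₄ :: R) := by obtain ⟨n, hn⟩ := hrot; exact hn ▸ hl.rotate n
  obtain ⟨-, ⟨i, hi⟩, ⟨j, hj⟩, -, -⟩ := hL.window
  have hx₁ : x₁ = q + dir (i + 2) := by rw [← neg_dir, hi]; abel
  have m₁ : q + dir (i + 2) ∈ l := by rw [← hx₁, hrot.mem_iff]; simp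
  have m₃ : q + dir j ∈ l := by rw [← hj, hrot.mem_iff]; simp
  have hne : x₁ ≠ x₃ := by
    have := hL.nodup
    simp only [nodup_cons, mem_cons, not_or] at this
    exact this.2.1.2.1
  refine ⟨x₀, x₁, x₃, x₄, R, hrot, ?_⟩
  rcases dir_eq_of_topleft htop m₁ with h1 | h1 <;> rcases dir_eq_of_topleft htop m₃ with h3 | h3 <;>
    rw [h1] at hx₁ <;> rw [h3] at hj
  · exact absurd (hx₁.trans hj.symm) hne
  · exact Or.inl ⟨hx₁, hj⟩
  · exact Or.inr ⟨hx₁, hj⟩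
  · exact absurd (hx₁.trans hj.symm) hne

/-- The window around the `m`-th vertex, with its two neighbours identified by index.
[folklore] -/
theorem window_at {l : List (ℤ × ℤ)} (h5 : 5 ≤ l.length) {m : ℕ} (hm : m < l.length) :
    ∃ y₀ y₄ R, l.rotate (m + (l.length - 2)) =
      y₀ :: l[(m + (l.length - 1)) % l.length]'(Nat.mod_lt _ (by omega)) :: l[m] ::
        l[(m + 1) % l.length]'(Nat.mod_lt _ (by omega)) :: y₄ :: R := by
  have hlen : (l.rotate (m + (l.length - 2))).length = l.length := length_rotate _ _
  obtain ⟨a, b, c, d, e, r, hr⟩ := exists_five (l := l.rotate (m + (l.length - 2))) (by omega)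
  have k1 : (l.rotate (m + (l.length - 2)))[1]'(by omega) = l[(m + (l.length - 1)) % l.length]'(Nat.mod_lt _ (by omega)) := by
    rw [getElem_rotate]; congr 1; congr 1; omega
  have k2 : (l.rotate (m + (l.length - 2)))[2]'(by omega) = l[m] := by
    rw [getElem_rotate]; congr 1
    rw [show 2 + (m + (l.length - 2)) = m + l.length by omega, Nat.add_mod_right, Nat.mod_eq_of_lt hm]
  have k3 : (l.rotate (m + (l.length - 2)))[3]'(by omega) = l[(m + 1) % l.length]'(Nat.mod_lt _ (by omega)) := by
    rw [getElem_rotate]; congr 1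
    rw [show 3 + (m + (l.length - 2)) = (m + 1) + l.length by omega, Nat.add_mod_right]
  have h1 : (l.rotate (m + (l.length - 2)))[1]'(by omega) = b := by rw [getElem_of_eq hr]; rfl
  have h2 : (l.rotate (m + (l.length - 2)))[2]'(by omega) = c := by rw [getElem_of_eq hr]; rfl
  have h3 : (l.rotate (m + (l.length - 2)))[3]'(by omega) = d := by rw [getElem_of_eq hr]; rfl
  refine ⟨a, e, r, ?_⟩
  rw [hr, ← k1, h1, ← k2, h2, ← k3, h3]

/-- **Moving along the diagonal.** If `v` is a corner of type `{e₀, -e₁}` of the loop and the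
opposite cell corner `v' = v + e₀ - e₁` is a vertex of the loop other than the two vertices at
distance two from `v` along the loop, then `v'` is again a corner of type `{e₀, -e₁}`: its
neighbours cannot be the neighbours `v + e₀`, `v - e₁` of `v` (their other neighbours are
known), so they are `v' + e₀` and `v' - e₁`. [folklore] -/
theorem cornerAt_next {x₀ x₁ v x₃ x₄ : ℤ × ℤ} {R : List (ℤ × ℤ)}
    (hL : IsLoop (x₀ :: x₁ :: v :: x₃ :: x₄ :: R))
    (h13 : (x₁ = v + dir 0 ∧ x₃ = v + dir 3) ∨ (x₁ = v + dir 3 ∧ x₃ = v + dir 0))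
    (hm : v + dir 0 + dir 3 ∈ x₀ :: x₁ :: v :: x₃ :: x₄ :: R)
    (h0 : v + dir 0 + dir 3 ≠ x₀) (h4 : v + dir 0 + dir 3 ≠ x₄) :
    CornerAt (x₀ :: x₁ :: v :: x₃ :: x₄ :: R) (v + dir 0 + dir 3) := by
  set L := x₀ :: x₁ :: v :: x₃ :: x₄ :: R with hLdef
  set v' := v + dir 0 + dir 3 with hv'
  have hnd := hL.nodup
  obtain ⟨m, hm, hmv⟩ := getElem_of_mem hm
  have hlen : L.length = R.length + 5 := by simp [hLdef]
  -- `v'` is none of the five explicit vertices, so `5 ≤ m`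
  have hne1 : v' ≠ x₁ := by
    rcases h13 with ⟨e, -⟩ | ⟨e, -⟩ <;> rw [e, hv'] <;> simp [dir, Prod.ext_iff]
  have hne2 : v' ≠ v := by rw [hv']; simp [dir, Prod.ext_iff]
  have hne3 : v' ≠ x₃ := by
    rcases h13 with ⟨-, e⟩ | ⟨-, e⟩ <;> rw [e, hv'] <;> simp [dir, Prod.ext_iff]
  have hm5 : 5 ≤ m := by
    rcases Nat.lt_or_ge m 5 with hlt | hge
    · interval_cases m
      · exact absurd hmv.symm h0
      · exact absurd hmv.symm hne1
      · exact absurd hmv.symm hne2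
      · exact absurd hmv.symm hne3
      · exact absurd hmv.symm h4
    · exact hge
  obtain ⟨y₀, y₄, R₂, hW⟩ := window_at (l := L) (by omega) hm
  rw [hmv] at hW
  have hrot : L ~r _ := ⟨_, hW⟩
  have hLW : IsLoop _ := hW ▸ hL.rotate (m + (L.length - 2))
  obtain ⟨-, ⟨i, hi⟩, ⟨j, hj⟩, -, -⟩ := hLW.window
  -- the neighbours of `v'` by index
  have hpred : (m + (L.length - 1)) % L.length = m - 1 := by
    rw [show m + (L.length - 1) = (m - 1) + L.length by omega, Nat.add_mod_right, Nat.mod_eq_of_lt (by omega)]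
  have hx₁L : L[1]'(by omega) = x₁ := rfl
  have hx₃L : L[3]'(by omega) = x₃ := rfl
  -- `y₁ = L[m-1]` is neither `x₁ = L[1]` nor `x₃ = L[3]`; `y₃ = L[(m+1) % n]` likewise
  have hy₁1 : L[(m + (L.length - 1)) % L.length]'(Nat.mod_lt _ (by omega)) ≠ x₁ := by
    rw [← hx₁L, Ne, hnd.getElem_inj_iff]; omega
  have hy₁3 : L[(m + (L.length - 1)) % L.length]'(Nat.mod_lt _ (by omega)) ≠ x₃ := by
    rw [← hx₃L, Ne, hnd.getElem_inj_iff]; omega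
  have hsucc' : (m + 1) % L.length = m + 1 ∨ (m + 1) % L.length = 0 := by
    rcases Nat.lt_or_ge (m + 1) L.length with hlt | hge
    · exact Or.inl (Nat.mod_eq_of_lt hlt)
    · have : m + 1 = L.length := by omega
      rw [this, Nat.mod_self]; exact Or.inr rfl
  have hsucc : (m + 1) % L.length ≠ 1 ∧ (m + 1) % L.length ≠ 3 := by omega
  have hy₃1 : L[(m + 1) % L.length]'(Nat.mod_lt _ (by omega)) ≠ x₁ := by
    rw [← hx₁L, Ne, hnd.getElem_inj_iff]; exact hsucc.1
  have hy₃3 : L[(m + 1) % L.length]'(Nat.mod_lt _ (by omega)) ≠ x₃ := by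
    rw [← hx₃L, Ne, hnd.getElem_inj_iff]; exact hsucc.2
  have hy13 : L[(m + (L.length - 1)) % L.length]'(Nat.mod_lt _ (by omega)) ≠
      L[(m + 1) % L.length]'(Nat.mod_lt _ (by omega)) := by
    rw [Ne, hnd.getElem_inj_iff, hpred]; omega
  -- the set `{x₁, x₃}` is `{v' + dir 1, v' + dir 2}`
  have hup : v' + dir 1 = x₁ ∨ v' + dir 1 = x₃ := by
    rcases h13 with ⟨e, -⟩ | ⟨-, e⟩ <;> [left; right] <;> rw [e, hv'] <;> simp [dir, Prod.ext_iff]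
  have hleft : v' + dir 2 = x₁ ∨ v' + dir 2 = x₃ := by
    rcases h13 with ⟨-, e⟩ | ⟨e, -⟩ <;> [right; left] <;> rw [e, hv'] <;> simp [dir, Prod.ext_iff]
  -- directions of the neighbours of `v'`
  have hy₁ : L[(m + (L.length - 1)) % L.length]'(Nat.mod_lt _ (by omega)) = v' + dir (i + 2) := by
    rw [← neg_dir, hi]; abel
  have hc1 : i + 2 = 0 ∨ i + 2 = 3 := by
    generalize i + 2 = c at hy₁
    have c1 : c ≠ 1 := by rintro rfl; rcases hup with e | e; exact hy₁1 (hy₁.trans e); exact hy₁3 (hy₁.trans e)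
    have c2 : c ≠ 2 := by rintro rfl; rcases hleft with e | e; exact hy₁1 (hy₁.trans e); exact hy₁3 (hy₁.trans e)
    fin_cases c <;> simp at c1 c2 ⊢
  have hc3 : j = 0 ∨ j = 3 := by
    have c1 : j ≠ 1 := by rintro rfl; rcases hup with e | e; exact hy₃1 (hj.trans e); exact hy₃3 (hj.trans e)
    have c2 : j ≠ 2 := by rintro rfl; rcases hleft with e | e; exact hy₃1 (hj.trans e); exact hy₃3 (hj.trans e)
    fin_cases j <;> simp at c1 c2 ⊢
  refine ⟨y₀, _, _, y₄, R₂, hrot, ?_⟩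
  rcases hc1 with h1 | h1 <;> rcases hc3 with h3 | h3 <;> rw [h1] at hy₁ <;> rw [h3] at hj
  · exact absurd (hy₁.trans hj.symm) hy13
  · exact Or.inl ⟨hy₁, hj⟩
  · exact Or.inr ⟨hy₁, hj⟩
  · exact absurd (hy₁.trans hj.symm) hy13

end RectLoop

end Literature.Topology.PlaneTopology
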